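import Mathlib
import Summits.Ventures.PercRepro2.Defs
import Summits.Ventures.PercRepro2.Independence
import Summits.Ventures.PercRepro2.Harris
import Summits.Ventures.PercRepro2.CoinDefs
import Summits.Ventures.PercRepro2.CoinArcsOff
import Summits.Ventures.PercRepro2.CoinPendantDefs
import Summits.Ventures.PercRepro2.CoinPendant
import Summits.Ventures.PercRepro2.CoinInduced
import Summits.Ventures.PercRepro2.CoinVdBK
import Summits.Ventures.PercRepro2.CoinBHK
import Summits.Ventures.PercRepro2.CoinReverse
import Summits.Ventures.PercRepro2.CoinLemmaA
import Summits.Ventures.PercRepro2.CoinDarcMixed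
import Summits.Ventures.PercRepro2.CoinTwoPendantDefs
import Summits.Ventures.PercRepro2.CoinTwoPendantMass
import Summits.Ventures.PercRepro2.CoinTraceLevels
import Summits.Ventures.PercRepro2.CoinTraceTower
import Summits.Ventures.PercRepro2.CoinTracePin
import Summits.Ventures.PercRepro2.CoinTracePin2
import Summits.Ventures.PercRepro2.CoinTracePinTransfer
import Summits.Ventures.PercRepro2.CoinTraceReduce
import Summits.Ventures.PercRepro2.CoinTraceFn
import Summits.Ventures.PercRepro2.CoinTraceBlock
import Summits.Ventures.PercRepro2.CoinTraceShift
import Summits.Ventures.PercRepro2.CoinTwoStarAbstract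
import Summits.Ventures.PercRepro2.CoinTwoStar
import Summits.Ventures.PercRepro2.CoinTraceBlocks
import Summits.Ventures.PercRepro2.CoinPathStarAbstract
import Summits.Ventures.PercRepro2.CoinPathStar
import Summits.Ventures.PercRepro2.CoinTraceBlocks2
import Summits.Ventures.PercRepro2.CoinPathStarHard
import Summits.Ventures.PercRepro2.CoinPathStarAbstract2

/-!
# Row 2′DARC at the PATHSTAR head on ALL regimes (blind cell PercRepro2, night-2 g4;
proofs/NIGHT2-DARC.md §23)

`P = {w, v₁, v₂, v₃}` with `w → v₁ → v₂ → t`, `w → v₃ → t`: the leaves `v₂`, `v₃` decided by single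
pendant coins `e₃`, `e₅`, the inner vertex `v₁` by the two coins `e₂, e₃`, `v₁ ∈ K⁻ ⟹ v₂ ∈ K⁻`,
and the head reaching `t` only through `v₁v₂` or `v₃`.  The subadditivity hypothesis of
`darc_of_pathStar_mixed_of_subadd` (g3, §19.4) is REMOVED: the abstract lemma
`pathStar_functional_nonneg'` (seven good families, the hard up-set `{wv₂v₃, P}` handled by the
three-case sign argument of §23.1) needs one more input, (CU-PA) on the PAIR cylinder
`{Z ⊇ {v₂, v₃}}`, supplied by pinning the two leaf coins (`trace_cu_pa_pair`, CoinTracePinTransfer.lean).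
-/

namespace Summit.Ventures.PercRepro2.Coin

section PathStarAll

open Classical

variable {V : Type*} {E : Type*} [Fintype V] [DecidableEq V] [Fintype E] [DecidableEq E]
  {R : Type*} [Field R] [LinearOrder R] [IsStrictOrderedRing R]

/-- **THEOREM (the pathstar head, ALL regimes).** -/
theorem darc_of_pathStar_mixed (p : E → R) (hp : IsProbVec p)
    {arcs : E → Finset (V × V)} (hS : SameEnds arcs) (s a b u w v₁ v₂ v₃ t : V)
    (hwv₁ : w ≠ v₁) (hwv₂ : w ≠ v₂) (hwv₃ : w ≠ v₃) (hv₁₂ : v₁ ≠ v₂) (hv₁₃ : v₁ ≠ v₃)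
    (hv₂₃ : v₂ ≠ v₃) (hclosed : ClosedOut arcs ({w, v₁, v₂, v₃} : Finset V) {t}) (hT : TailCoinsIn arcs ({w, v₁, v₂, v₃} : Finset V) {t})
    {e₂ e₃ e₅ : E} (hne₂₃ : e₂ ≠ e₃) (hc₂ : e₂ ∈ tailCoins arcs ({w, v₁, v₂, v₃} : Finset V)) (hc₃ : e₃ ∈ tailCoins arcs ({w, v₁, v₂, v₃} : Finset V))
    (hc₅ : e₅ ∈ tailCoins arcs ({w, v₁, v₂, v₃} : Finset V))
    (hleaf₁ : bwdEvent arcs v₁ {t} = openEdge e₂ ∩ openEdge e₃)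
    (hleaf₂ : bwdEvent arcs v₂ {t} = openEdge e₃) (hleaf₃ : bwdEvent arcs v₃ {t} = openEdge e₅)
    (himp : ∀ ω : Config E, ω ∈ bwdEvent arcs v₁ {t} → ω ∈ bwdEvent arcs v₂ {t})
    (hexit : ∀ ω : Config E, ω ∈ bwdEvent arcs w {t} →
      (ω ∈ bwdEvent arcs v₁ {t} ∧ ω ∈ bwdEvent arcs v₂ {t}) ∨ ω ∈ bwdEvent arcs v₃ {t})
    (ha : a ∉ ({w, v₁, v₂, v₃} : Finset V) ∪ {t}) (hb : b ∉ ({w, v₁, v₂, v₃} : Finset V) ∪ {t}) (hu : u ∉ ({w, v₁, v₂, v₃} : Finset V) ∪ {t})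
    (hP : ∀ Z ∈ ({w, v₁, v₂, v₃} : Finset V).powerset, 0 < prob p (avoidEvent (arcsOff arcs (({w, v₁, v₂, v₃} : Finset V) ∪ {t})) s (Z ∪ {t})))
    (hQ : ∀ Z ∈ ({w, v₁, v₂, v₃} : Finset V).powerset,
      0 < prob p (avoidEvent (arcsOff arcs (({w, v₁, v₂, v₃} : Finset V) ∪ {t})) s (gateTarget u w Z {t}))) :
    DARC p arcs s {t} a b u w := by
  have hwP : w ∈ ({w, v₁, v₂, v₃} : Finset V) := by simp
  have hv₁P : v₁ ∈ ({w, v₁, v₂, v₃} : Finset V) := by simp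
  have hv₂P : v₂ ∈ ({w, v₁, v₂, v₃} : Finset V) := by simp
  have hv₃P : v₃ ∈ ({w, v₁, v₂, v₃} : Finset V) := by simp
  have hS₀ : SameEnds (arcsOff arcs (({w, v₁, v₂, v₃} : Finset V) ∪ {t})) := sameEnds_arcsOff hS _
  refine darc_of_trace_functional p hp hS hclosed hT s a b u w hwP ha hb hu hQ ?_
  set D₀ := arcsOff arcs (({w, v₁, v₂, v₃} : Finset V) ∪ {t}) with hD₀
  set X₀ : Config E → R := marker D₀ s a with hX₀
  set Y₀ : Config E → R := marker D₀ s b with hY₀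
  set ℓ : Finset V → R := fun Z => prob p (traceLevel arcs {t} ({w, v₁, v₂, v₃} : Finset V) Z) with hℓ
  set Pz : Finset V → R := fun Z => prob p (avoidEvent D₀ s (Z ∪ {t})) with hPz
  set Qz : Finset V → R := fun Z => prob p (avoidEvent D₀ s (gateTarget u w Z {t})) with hQz
  set Az : Finset V → R := fun Z => massE p X₀ (avoidEvent D₀ s (Z ∪ {t})) with hAz
  set Bz : Finset V → R := fun Z => massE p Y₀ (avoidEvent D₀ s (Z ∪ {t})) with hBz
  set Ahz : Finset V → R := fun Z => massE p X₀ (avoidEvent D₀ s (gateTarget u w Z {t})) with hAhz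
  set Bhz : Finset V → R := fun Z => massE p Y₀ (avoidEvent D₀ s (gateTarget u w Z {t})) with hBhz
  have hPpos : ∀ Z : Finset V, Z ⊆ ({w, v₁, v₂, v₃} : Finset V) → 0 < Pz Z := fun Z hZ => hP Z (Finset.mem_powerset.mpr hZ)
  have hQpos : ∀ Z : Finset V, Z ⊆ ({w, v₁, v₂, v₃} : Finset V) → 0 < Qz Z := fun Z hZ => hQ Z (Finset.mem_powerset.mpr hZ)
  have hMX : ∑ Z ∈ ({w, v₁, v₂, v₃} : Finset V).powerset, Az Z / Pz Z * (ℓ Z * Pz Z) = ∑ Z ∈ ({w, v₁, v₂, v₃} : Finset V).powerset, ℓ Z * Az Z := by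
    refine Finset.sum_congr rfl fun Z hZ => ?_
    have := (hPpos Z (Finset.mem_powerset.mp hZ)).ne'
    field_simp
  have hMY : ∑ Z ∈ ({w, v₁, v₂, v₃} : Finset V).powerset, Bz Z / Pz Z * (ℓ Z * Pz Z) = ∑ Z ∈ ({w, v₁, v₂, v₃} : Finset V).powerset, ℓ Z * Bz Z := by
    refine Finset.sum_congr rfl fun Z hZ => ?_
    have := (hPpos Z (Finset.mem_powerset.mp hZ)).ne'
    field_simp
  have key : ∑ Z ∈ ({w, v₁, v₂, v₃} : Finset V).powerset, ℓ Z * Pz Z * (Qz Z / Pz Z) *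
        (Ahz Z / Qz Z * (∑ Z' ∈ ({w, v₁, v₂, v₃} : Finset V).powerset, ℓ Z' * Pz Z')
          - ∑ Z' ∈ ({w, v₁, v₂, v₃} : Finset V).powerset, Az Z' / Pz Z' * (ℓ Z' * Pz Z')) *
        (Bhz Z / Qz Z * (∑ Z' ∈ ({w, v₁, v₂, v₃} : Finset V).powerset, ℓ Z' * Pz Z')
          - ∑ Z' ∈ ({w, v₁, v₂, v₃} : Finset V).powerset, Bz Z' / Pz Z' * (ℓ Z' * Pz Z')) =
      ∑ Z ∈ ({w, v₁, v₂, v₃} : Finset V).powerset, ℓ Z * Qz Z *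
        (Ahz Z / Qz Z * (∑ Z' ∈ ({w, v₁, v₂, v₃} : Finset V).powerset, ℓ Z' * Pz Z') - ∑ Z' ∈ ({w, v₁, v₂, v₃} : Finset V).powerset, ℓ Z' * Az Z') *
        (Bhz Z / Qz Z * (∑ Z' ∈ ({w, v₁, v₂, v₃} : Finset V).powerset, ℓ Z' * Pz Z') - ∑ Z' ∈ ({w, v₁, v₂, v₃} : Finset V).powerset, ℓ Z' * Bz Z') := by
    rw [hMX, hMY]
    refine Finset.sum_congr rfl fun Z hZ => ?_
    have := (hPpos Z (Finset.mem_powerset.mp hZ)).ne'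
    field_simp
  rw [← key]
  have hμ : ∀ Z ∈ ({w, v₁, v₂, v₃} : Finset V).powerset, 0 ≤ ℓ Z * Pz Z :=
    fun Z _ => mul_nonneg (prob_nonneg hp _) (prob_nonneg hp _)
  have hμ0a : ∀ Z ∈ ({w, v₁, v₂, v₃} : Finset V).powerset, v₁ ∈ Z → v₂ ∉ Z → ℓ Z * Pz Z = 0 := by
    intro Z _ h1 h2
    have : ℓ Z = 0 := by
      show prob p (traceLevel arcs {t} ({w, v₁, v₂, v₃} : Finset V) Z) = 0
      rw [traceLevel_eq_empty_of_implies hv₁P hv₂P himp h1 h2, prob_empty]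
    rw [this, zero_mul]
  have hμ0b : ∀ Z ∈ ({w, v₁, v₂, v₃} : Finset V).powerset, w ∈ Z → ¬ (v₁ ∈ Z ∧ v₂ ∈ Z) → v₃ ∉ Z → ℓ Z * Pz Z = 0 := by
    intro Z _ hw h12 h3
    have : ℓ Z = 0 := by
      show prob p (traceLevel arcs {t} ({w, v₁, v₂, v₃} : Finset V) Z) = 0
      rw [traceLevel_eq_empty_of_head_exit hwP hv₁P hv₂P hv₃P hexit hw h12 h3, prob_empty]
    rw [this, zero_mul]
  have hx1 : ∀ Z : Finset V, Z ⊆ ({w, v₁, v₂, v₃} : Finset V) → Az Z / Pz Z ≤ 1 := fun Z hZ =>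
    (div_le_one₀ (hPpos Z hZ)).mpr (massE_marker_le_prob p hp D₀ s a _)
  have hy1 : ∀ Z : Finset V, Z ⊆ ({w, v₁, v₂, v₃} : Finset V) → Bz Z / Pz Z ≤ 1 := fun Z hZ =>
    (div_le_one₀ (hPpos Z hZ)).mpr (massE_marker_le_prob p hp D₀ s b _)
  have hxh1 : ∀ Z : Finset V, Z ⊆ ({w, v₁, v₂, v₃} : Finset V) → Ahz Z / Qz Z ≤ 1 := fun Z hZ =>
    (div_le_one₀ (hQpos Z hZ)).mpr (massE_marker_le_prob p hp D₀ s a _)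
  have hyh1 : ∀ Z : Finset V, Z ⊆ ({w, v₁, v₂, v₃} : Finset V) → Bhz Z / Qz Z ≤ 1 := fun Z hZ =>
    (div_le_one₀ (hQpos Z hZ)).mpr (massE_marker_le_prob p hp D₀ s b _)
  have hxanti : ∀ Z Z' : Finset V, Z ⊆ Z' → Z' ⊆ ({w, v₁, v₂, v₃} : Finset V) → Az Z' / Pz Z' ≤ Az Z / Pz Z :=
    fun Z Z' hZZ' hZ'P => (div_le_div_iff₀ (hPpos Z' hZ'P) (hPpos Z (hZZ'.trans hZ'P))).mpr
      (shift_avoid_more_C p hp hS₀ s a (Finset.union_subset_union_left hZZ'))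
  have hyanti : ∀ Z Z' : Finset V, Z ⊆ Z' → Z' ⊆ ({w, v₁, v₂, v₃} : Finset V) → Bz Z' / Pz Z' ≤ Bz Z / Pz Z :=
    fun Z Z' hZZ' hZ'P => (div_le_div_iff₀ (hPpos Z' hZ'P) (hPpos Z (hZZ'.trans hZ'P))).mpr
      (shift_avoid_more_C p hp hS₀ s b (Finset.union_subset_union_left hZZ'))
  have hxhanti : ∀ Z Z' : Finset V, Z ⊆ Z' → Z' ⊆ ({w, v₁, v₂, v₃} : Finset V) → Ahz Z' / Qz Z' ≤ Ahz Z / Qz Z :=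
    fun Z Z' hZZ' hZ'P => (div_le_div_iff₀ (hQpos Z' hZ'P) (hQpos Z (hZZ'.trans hZ'P))).mpr
      (shift_avoid_more_C p hp hS₀ s a (gateTarget_mono u w hZZ' {t}))
  have hyhanti : ∀ Z Z' : Finset V, Z ⊆ Z' → Z' ⊆ ({w, v₁, v₂, v₃} : Finset V) → Bhz Z' / Qz Z' ≤ Bhz Z / Qz Z :=
    fun Z Z' hZZ' hZ'P => (div_le_div_iff₀ (hQpos Z' hZ'P) (hQpos Z (hZZ'.trans hZ'P))).mpr
      (shift_avoid_more_C p hp hS₀ s b (gateTarget_mono u w hZZ' {t}))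
  have hxh_le : ∀ Z : Finset V, Z ⊆ ({w, v₁, v₂, v₃} : Finset V) → Ahz Z / Qz Z ≤ Az Z / Pz Z := fun Z hZ =>
    (div_le_div_iff₀ (hQpos Z hZ) (hPpos Z hZ)).mpr
      (shift_avoid_more_C p hp hS₀ s a (subset_gateTarget u w Z {t}))
  have hyh_le : ∀ Z : Finset V, Z ⊆ ({w, v₁, v₂, v₃} : Finset V) → Bhz Z / Qz Z ≤ Bz Z / Pz Z := fun Z hZ =>
    (div_le_div_iff₀ (hQpos Z hZ) (hPpos Z hZ)).mpr
      (shift_avoid_more_C p hp hS₀ s b (subset_gateTarget u w Z {t}))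
  have hxh_eq : ∀ Z : Finset V, Z ⊆ ({w, v₁, v₂, v₃} : Finset V) → w ∉ Z → Ahz Z / Qz Z = Az Z / Pz Z := by
    intro Z _ hwZ
    show massE p X₀ (avoidEvent D₀ s (gateTarget u w Z {t})) /
        prob p (avoidEvent D₀ s (gateTarget u w Z {t})) = _
    rw [gateTarget_of_notMem hwZ]
  have hyh_eq : ∀ Z : Finset V, Z ⊆ ({w, v₁, v₂, v₃} : Finset V) → w ∉ Z → Bhz Z / Qz Z = Bz Z / Pz Z := by
    intro Z _ hwZ
    show massE p Y₀ (avoidEvent D₀ s (gateTarget u w Z {t})) /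
        prob p (avoidEvent D₀ s (gateTarget u w Z {t})) = _
    rw [gateTarget_of_notMem hwZ]
  have hρ1 : ∀ Z ∈ ({w, v₁, v₂, v₃} : Finset V).powerset, w ∉ Z → Qz Z / Pz Z = 1 := by
    intro Z hZ hwZ
    show prob p (avoidEvent D₀ s (gateTarget u w Z {t})) / prob p (avoidEvent D₀ s (Z ∪ {t})) = 1
    rw [gateTarget_of_notMem hwZ]
    exact div_self (hP Z hZ).ne'
  have hρle : Qz ({w, v₁, v₂, v₃} : Finset V) / Pz ({w, v₁, v₂, v₃} : Finset V) ≤ 1 :=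
    (div_le_one₀ (hPpos ({w, v₁, v₂, v₃} : Finset V) (subset_refl _))).mpr
      (prob_mono hp fun ω hω t' ht' => hω t' (subset_gateTarget u w ({w, v₁, v₂, v₃} : Finset V) {t} ht'))
  -- the pivotal weights of the three minimal pivotal traces and the top
  have h12P : ({w, v₁, v₂} : Finset V) ⊆ ({w, v₁, v₂, v₃} : Finset V) := by simp [Finset.insert_subset_iff]
  have h3P : ({w, v₃} : Finset V) ⊆ ({w, v₁, v₂, v₃} : Finset V) := by simp [Finset.insert_subset_iff]
  have h23P : ({w, v₂, v₃} : Finset V) ⊆ ({w, v₁, v₂, v₃} : Finset V) := by simp [Finset.insert_subset_iff]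
  have h3_23 : ({w, v₃} : Finset V) ⊆ {w, v₂, v₃} := by simp [Finset.insert_subset_iff]
  have hρ₁₂ : Qz {w, v₁, v₂} / Pz {w, v₁, v₂} ≤ Qz ({w, v₁, v₂, v₃} : Finset V) / Pz ({w, v₁, v₂, v₃} : Finset V) :=
    (div_le_div_iff₀ (hPpos _ h12P) (hPpos ({w, v₁, v₂, v₃} : Finset V) (subset_refl _))).mpr
      (rho_mono_of_subset p hp hS s u w hu h12P (subset_refl _) (by simp))
  have hρ₂₃ : Qz {w, v₂, v₃} / Pz {w, v₂, v₃} ≤ Qz ({w, v₁, v₂, v₃} : Finset V) / Pz ({w, v₁, v₂, v₃} : Finset V) :=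
    (div_le_div_iff₀ (hPpos _ h23P) (hPpos ({w, v₁, v₂, v₃} : Finset V) (subset_refl _))).mpr
      (rho_mono_of_subset p hp hS s u w hu h23P (subset_refl _) (by simp))
  have hρ₃₂₃ : Qz {w, v₃} / Pz {w, v₃} ≤ Qz {w, v₂, v₃} / Pz {w, v₂, v₃} :=
    (div_le_div_iff₀ (hPpos _ h3P) (hPpos _ h23P)).mpr
      (rho_mono_of_subset p hp hS s u w hu h3_23 h23P (by simp))
  have hρ₃0 : 0 ≤ Qz {w, v₃} / Pz {w, v₃} := div_nonneg (prob_nonneg hp _) (prob_nonneg hp _)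
  -- the positive-association inputs
  have hPA : TracePA ({w, v₁, v₂, v₃} : Finset V) (fun Z => ℓ Z * Pz Z) := by
    intro U hU f₁ f₂ h₁ h₂ h₁0 h₂0
    have h := trace_pa p hp hS hclosed hT hU s (monotone_traceFn ({w, v₁, v₂, v₃} : Finset V) h₁) (monotone_traceFn ({w, v₁, v₂, v₃} : Finset V) h₂)
      (traceFn_nonneg ({w, v₁, v₂, v₃} : Finset V) h₁0) (traceFn_nonneg ({w, v₁, v₂, v₃} : Finset V) h₂0)
    have e₁ : ∑ Z ∈ ({w, v₁, v₂, v₃} : Finset V).powerset.filter (fun Z => Disjoint Z U),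
        traceFn ({w, v₁, v₂, v₃} : Finset V) f₁ ↑Z * (ℓ Z * Pz Z) =
        ∑ Z ∈ ({w, v₁, v₂, v₃} : Finset V).powerset.filter (fun Z => Disjoint Z U), f₁ Z * (ℓ Z * Pz Z) :=
      Finset.sum_congr rfl fun Z hZ => by
        rw [traceFn_coe ({w, v₁, v₂, v₃} : Finset V) f₁ (Finset.mem_powerset.mp (Finset.mem_filter.mp hZ).1)]
    have e₂ : ∑ Z ∈ ({w, v₁, v₂, v₃} : Finset V).powerset.filter (fun Z => Disjoint Z U),
        traceFn ({w, v₁, v₂, v₃} : Finset V) f₂ ↑Z * (ℓ Z * Pz Z) =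
        ∑ Z ∈ ({w, v₁, v₂, v₃} : Finset V).powerset.filter (fun Z => Disjoint Z U), f₂ Z * (ℓ Z * Pz Z) :=
      Finset.sum_congr rfl fun Z hZ => by
        rw [traceFn_coe ({w, v₁, v₂, v₃} : Finset V) f₂ (Finset.mem_powerset.mp (Finset.mem_filter.mp hZ).1)]
    have e₁₂ : ∑ Z ∈ ({w, v₁, v₂, v₃} : Finset V).powerset.filter (fun Z => Disjoint Z U),
        traceFn ({w, v₁, v₂, v₃} : Finset V) f₁ ↑Z * traceFn ({w, v₁, v₂, v₃} : Finset V) f₂ ↑Z * (ℓ Z * Pz Z) =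
        ∑ Z ∈ ({w, v₁, v₂, v₃} : Finset V).powerset.filter (fun Z => Disjoint Z U), f₁ Z * f₂ Z * (ℓ Z * Pz Z) :=
      Finset.sum_congr rfl fun Z hZ => by
        rw [traceFn_coe ({w, v₁, v₂, v₃} : Finset V) f₁ (Finset.mem_powerset.mp (Finset.mem_filter.mp hZ).1),
          traceFn_coe ({w, v₁, v₂, v₃} : Finset V) f₂ (Finset.mem_powerset.mp (Finset.mem_filter.mp hZ).1)]
    rw [e₁, e₂, e₁₂] at h
    exact h
  have hCUconv : ∀ (v : V) (f₁ f₂ : Finset V → R),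
      (∑ Z ∈ ({w, v₁, v₂, v₃} : Finset V).powerset.filter (fun Z => v ∈ Z),
          traceFn ({w, v₁, v₂, v₃} : Finset V) f₁ ↑Z * (ℓ Z * Pz Z)) *
        (∑ Z ∈ ({w, v₁, v₂, v₃} : Finset V).powerset.filter (fun Z => v ∈ Z), traceFn ({w, v₁, v₂, v₃} : Finset V) f₂ ↑Z * (ℓ Z * Pz Z)) ≤
      (∑ Z ∈ ({w, v₁, v₂, v₃} : Finset V).powerset.filter (fun Z => v ∈ Z),
          traceFn ({w, v₁, v₂, v₃} : Finset V) f₁ ↑Z * traceFn ({w, v₁, v₂, v₃} : Finset V) f₂ ↑Z * (ℓ Z * Pz Z)) *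
        ∑ Z ∈ ({w, v₁, v₂, v₃} : Finset V).powerset.filter (fun Z => v ∈ Z), ℓ Z * Pz Z →
      (∑ Z ∈ ({w, v₁, v₂, v₃} : Finset V).powerset.filter (fun Z => v ∈ Z), f₁ Z * (ℓ Z * Pz Z)) *
        (∑ Z ∈ ({w, v₁, v₂, v₃} : Finset V).powerset.filter (fun Z => v ∈ Z), f₂ Z * (ℓ Z * Pz Z)) ≤
      (∑ Z ∈ ({w, v₁, v₂, v₃} : Finset V).powerset.filter (fun Z => v ∈ Z), f₁ Z * f₂ Z * (ℓ Z * Pz Z)) *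
        ∑ Z ∈ ({w, v₁, v₂, v₃} : Finset V).powerset.filter (fun Z => v ∈ Z), ℓ Z * Pz Z := by
    intro v f₁ f₂ h
    have e₁ : ∑ Z ∈ ({w, v₁, v₂, v₃} : Finset V).powerset.filter (fun Z => v ∈ Z), traceFn ({w, v₁, v₂, v₃} : Finset V) f₁ ↑Z * (ℓ Z * Pz Z) =
        ∑ Z ∈ ({w, v₁, v₂, v₃} : Finset V).powerset.filter (fun Z => v ∈ Z), f₁ Z * (ℓ Z * Pz Z) :=
      Finset.sum_congr rfl fun Z hZ => by
        rw [traceFn_coe ({w, v₁, v₂, v₃} : Finset V) f₁ (Finset.mem_powerset.mp (Finset.mem_filter.mp hZ).1)]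
    have e₂ : ∑ Z ∈ ({w, v₁, v₂, v₃} : Finset V).powerset.filter (fun Z => v ∈ Z), traceFn ({w, v₁, v₂, v₃} : Finset V) f₂ ↑Z * (ℓ Z * Pz Z) =
        ∑ Z ∈ ({w, v₁, v₂, v₃} : Finset V).powerset.filter (fun Z => v ∈ Z), f₂ Z * (ℓ Z * Pz Z) :=
      Finset.sum_congr rfl fun Z hZ => by
        rw [traceFn_coe ({w, v₁, v₂, v₃} : Finset V) f₂ (Finset.mem_powerset.mp (Finset.mem_filter.mp hZ).1)]
    have e₁₂ : ∑ Z ∈ ({w, v₁, v₂, v₃} : Finset V).powerset.filter (fun Z => v ∈ Z),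
        traceFn ({w, v₁, v₂, v₃} : Finset V) f₁ ↑Z * traceFn ({w, v₁, v₂, v₃} : Finset V) f₂ ↑Z * (ℓ Z * Pz Z) =
        ∑ Z ∈ ({w, v₁, v₂, v₃} : Finset V).powerset.filter (fun Z => v ∈ Z), f₁ Z * f₂ Z * (ℓ Z * Pz Z) :=
      Finset.sum_congr rfl fun Z hZ => by
        rw [traceFn_coe ({w, v₁, v₂, v₃} : Finset V) f₁ (Finset.mem_powerset.mp (Finset.mem_filter.mp hZ).1),
          traceFn_coe ({w, v₁, v₂, v₃} : Finset V) f₂ (Finset.mem_powerset.mp (Finset.mem_filter.mp hZ).1)]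
    rw [e₁, e₂, e₁₂] at h
    exact h
  have hCU₁ : TraceCUPA ({w, v₁, v₂, v₃} : Finset V) (fun Z => ℓ Z * Pz Z) v₁ := fun f₁ f₂ h₁ h₂ h₁0 h₂0 =>
    hCUconv v₁ f₁ f₂ (trace_cu_pa₂ p hp hS hclosed hT hv₁P hne₂₃ hc₂ hc₃ hleaf₁ s
      (monotone_traceFn ({w, v₁, v₂, v₃} : Finset V) h₁) (monotone_traceFn ({w, v₁, v₂, v₃} : Finset V) h₂) (traceFn_nonneg ({w, v₁, v₂, v₃} : Finset V) h₁0)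
      (traceFn_nonneg ({w, v₁, v₂, v₃} : Finset V) h₂0))
  have hCU₂ : TraceCUPA ({w, v₁, v₂, v₃} : Finset V) (fun Z => ℓ Z * Pz Z) v₂ := fun f₁ f₂ h₁ h₂ h₁0 h₂0 =>
    hCUconv v₂ f₁ f₂ (trace_cu_pa p hp hS hclosed hT hv₂P hc₃ hleaf₂ s
      (monotone_traceFn ({w, v₁, v₂, v₃} : Finset V) h₁) (monotone_traceFn ({w, v₁, v₂, v₃} : Finset V) h₂) (traceFn_nonneg ({w, v₁, v₂, v₃} : Finset V) h₁0)
      (traceFn_nonneg ({w, v₁, v₂, v₃} : Finset V) h₂0))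
  have hCU₃ : TraceCUPA ({w, v₁, v₂, v₃} : Finset V) (fun Z => ℓ Z * Pz Z) v₃ := fun f₁ f₂ h₁ h₂ h₁0 h₂0 =>
    hCUconv v₃ f₁ f₂ (trace_cu_pa p hp hS hclosed hT hv₃P hc₅ hleaf₃ s
      (monotone_traceFn ({w, v₁, v₂, v₃} : Finset V) h₁) (monotone_traceFn ({w, v₁, v₂, v₃} : Finset V) h₂) (traceFn_nonneg ({w, v₁, v₂, v₃} : Finset V) h₁0)
      (traceFn_nonneg ({w, v₁, v₂, v₃} : Finset V) h₂0))
  have hCU₂₃ : ∀ f₁ f₂ : Finset V → R,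
      (∀ Z Z' : Finset V, Z ⊆ Z' → Z' ⊆ ({w, v₁, v₂, v₃} : Finset V) → f₁ Z ≤ f₁ Z') →
      (∀ Z Z' : Finset V, Z ⊆ Z' → Z' ⊆ ({w, v₁, v₂, v₃} : Finset V) → f₂ Z ≤ f₂ Z') →
      (∀ Z : Finset V, Z ⊆ ({w, v₁, v₂, v₃} : Finset V) → 0 ≤ f₁ Z) →
      (∀ Z : Finset V, Z ⊆ ({w, v₁, v₂, v₃} : Finset V) → 0 ≤ f₂ Z) →
      (∑ Z ∈ ({w, v₁, v₂, v₃} : Finset V).powerset.filter (fun Z => v₂ ∈ Z ∧ v₃ ∈ Z), f₁ Z * (ℓ Z * Pz Z)) *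
          (∑ Z ∈ ({w, v₁, v₂, v₃} : Finset V).powerset.filter (fun Z => v₂ ∈ Z ∧ v₃ ∈ Z), f₂ Z * (ℓ Z * Pz Z)) ≤
        (∑ Z ∈ ({w, v₁, v₂, v₃} : Finset V).powerset.filter (fun Z => v₂ ∈ Z ∧ v₃ ∈ Z), f₁ Z * f₂ Z * (ℓ Z * Pz Z)) *
          ∑ Z ∈ ({w, v₁, v₂, v₃} : Finset V).powerset.filter (fun Z => v₂ ∈ Z ∧ v₃ ∈ Z), ℓ Z * Pz Z := by
    intro f₁ f₂ h₁ h₂ h₁0 h₂0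
    have h := trace_cu_pa_pair p hp hS hclosed hT hv₂P hv₃P hc₃ hc₅ hleaf₂ hleaf₃ s
      (monotone_traceFn ({w, v₁, v₂, v₃} : Finset V) h₁) (monotone_traceFn ({w, v₁, v₂, v₃} : Finset V) h₂)
      (traceFn_nonneg ({w, v₁, v₂, v₃} : Finset V) h₁0) (traceFn_nonneg ({w, v₁, v₂, v₃} : Finset V) h₂0)
    have e₁ : ∑ Z ∈ ({w, v₁, v₂, v₃} : Finset V).powerset.filter (fun Z => v₂ ∈ Z ∧ v₃ ∈ Z),
        traceFn ({w, v₁, v₂, v₃} : Finset V) f₁ ↑Z * (ℓ Z * Pz Z) =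
        ∑ Z ∈ ({w, v₁, v₂, v₃} : Finset V).powerset.filter (fun Z => v₂ ∈ Z ∧ v₃ ∈ Z), f₁ Z * (ℓ Z * Pz Z) :=
      Finset.sum_congr rfl fun Z hZ => by
        rw [traceFn_coe ({w, v₁, v₂, v₃} : Finset V) f₁ (Finset.mem_powerset.mp (Finset.mem_filter.mp hZ).1)]
    have e₂ : ∑ Z ∈ ({w, v₁, v₂, v₃} : Finset V).powerset.filter (fun Z => v₂ ∈ Z ∧ v₃ ∈ Z),
        traceFn ({w, v₁, v₂, v₃} : Finset V) f₂ ↑Z * (ℓ Z * Pz Z) =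
        ∑ Z ∈ ({w, v₁, v₂, v₃} : Finset V).powerset.filter (fun Z => v₂ ∈ Z ∧ v₃ ∈ Z), f₂ Z * (ℓ Z * Pz Z) :=
      Finset.sum_congr rfl fun Z hZ => by
        rw [traceFn_coe ({w, v₁, v₂, v₃} : Finset V) f₂ (Finset.mem_powerset.mp (Finset.mem_filter.mp hZ).1)]
    have e₁₂ : ∑ Z ∈ ({w, v₁, v₂, v₃} : Finset V).powerset.filter (fun Z => v₂ ∈ Z ∧ v₃ ∈ Z),
        traceFn ({w, v₁, v₂, v₃} : Finset V) f₁ ↑Z * traceFn ({w, v₁, v₂, v₃} : Finset V) f₂ ↑Z * (ℓ Z * Pz Z) =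
        ∑ Z ∈ ({w, v₁, v₂, v₃} : Finset V).powerset.filter (fun Z => v₂ ∈ Z ∧ v₃ ∈ Z), f₁ Z * f₂ Z * (ℓ Z * Pz Z) :=
      Finset.sum_congr rfl fun Z hZ => by
        rw [traceFn_coe ({w, v₁, v₂, v₃} : Finset V) f₁ (Finset.mem_powerset.mp (Finset.mem_filter.mp hZ).1),
          traceFn_coe ({w, v₁, v₂, v₃} : Finset V) f₂ (Finset.mem_powerset.mp (Finset.mem_filter.mp hZ).1)]
    rw [e₁, e₂, e₁₂] at h
    exact h
  have hρ₁₂0 : 0 ≤ Qz {w, v₁, v₂} / Pz {w, v₁, v₂} := div_nonneg (prob_nonneg hp _) (prob_nonneg hp _)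
  exact pathStar_functional_nonneg' hwv₁ hwv₂ hwv₃ hv₁₂ hv₁₃ hv₂₃ (fun Z => ℓ Z * Pz Z)
    (fun Z => Az Z / Pz Z) (fun Z => Bz Z / Pz Z) (fun Z => Ahz Z / Qz Z) (fun Z => Bhz Z / Qz Z)
    (fun Z => Qz Z / Pz Z) hμ hμ0a hμ0b hx1 hy1 hxh1 hyh1 hxanti hyanti hxhanti hyhanti
    hxh_le hyh_le hxh_eq hyh_eq hρ1 hρle hρ₃0 hρ₁₂0 hρ₃₂₃ hρ₂₃ hρ₁₂ hPA hCU₁ hCU₂ hCU₃ hCU₂₃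

end PathStarAll

end Summit.Ventures.PercRepro2.Coin
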